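import Mathlib
import Summits.MatrixMultiplication.MatrixMultiplication.Theses.FidelityWitnesses
import Literature.Computability.AlgebraicComplexity.SmallFormatRank
import Literature.Computability.AlgebraicComplexity.MatMulRankLowerBoundsBlaserProofs
import Literature.Computability.AlgebraicComplexity.AsymptoticRankZariskiClosedProofs

/-!
# `FidelityWitnesses.SevenEighthsLaw` (stmt-MatrixMultiplication-4959) — Negative lane:
# the constants `6` and `7` are both sharp, and what a disproof must be

Negative / support lemmas of the standing disprover (`Cruxes/SevenEighthsLaw/Disproof.lean`, §Transfer,
§(a), §(b)), landed for import by ideators, planners and the line lead.  No Theses statement is asserted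
positively here.  The crux says `|⟨S,⟨2,2,2⟩⟩|² ≤ 7·‖S‖²` for every complex tensor `S` of rank `≤ 6`
(`M(2,6) = 7`, the "7/8 law").

* `sevenEighthsLaw_not_of_int` — **kill switch**: an INTEGER tensor `Sz` with an integer rank-`≤ 6`
  certificate and `7·Σ Sz² < (Σ Sz·⟨2,2,2⟩)²` refutes the crux (base change `ℤ → ℂ`,
  `tensorRank_map_le`; both integer quantities are `decide`-able).  By homogeneity every counterexample
  can be brought to this form (Gaussian integers for genuinely complex ones).
* `sevenEighthsLaw_not_of_dist_lt_one` — metric form of a disproof: a rank-`≤ 6` tensor at distance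
  `< 1` from `⟨2,2,2⟩` refutes the crux (`‖T − S‖² ≥ 8 − |⟨S,T⟩|²/‖S‖²`).
* `sevenEighthsLaw_dist_ge_one` — conversely the crux puts every rank-`≤ 6` tensor at distance `≥ 1`
  from `⟨2,2,2⟩` (rescale by `c = conj ω/‖S‖²`, `tensorRank_smul_le`): the crux is EXACTLY
  "`dist(⟨2,2,2⟩, {R ≤ 6}) ≥ 1`".
* `sevenEighthsLaw_false_without_rank_bound`, `sevenEighthsLaw_false_with_rank_seven` — the rank
  hypothesis is the whole content and its threshold is sharp: `S = ⟨2,2,2⟩` gives `64 > 56`, and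
  Strassen's `R(⟨2,2,2⟩) ≤ 7` shows rank `7` already reaches ratio `8`.
* `sevenEighthsLaw_attained` — equality: `S = ⟨2,2,2⟩ − a₂₂⊗b₂₂⊗c₂₂` has honest rank `≤ 6`
  (six transported Strassen products, `SevenEighthsLawNeg.sixS_eq`, `decide`) and
  `|⟨S,T⟩|² = 49 = 7·‖S‖²`; the supremum `M(2,6) ≥ 7` is a maximum.
* `sevenEighthsLaw_biniFamily`, `sevenEighthsLaw_tight`, `sevenEighthsLaw_not_strengthened` — the
  constant `7` is sharp: the six integer triads `biniW/U/V m` (Bini's order-one scheme for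
  `⟨2,2,2⟩ ∖ a₂₂` plus the honest term `a₂₂ ⊗ b₂₁ ⊗ c₁₂`, at `ε = 1/m`, denominators cleared) sum to
  `m·(⟨2,2,2⟩ − a₂₂⊗b₂₂⊗c₂₂) + C₂` with overlap `7m` and squared norm `7m² + 4`, so honest rank-6 tensors
  reach ratio `7 − 28/(7m² + 4) ↑ 7`; hence for every `η > 0` the bound `7 − η` fails, e.g. `7 − 1/100`.
-/

namespace Summit.MatrixMultiplication.MatrixMultiplication.Theorems

open scoped BigOperators
open Literature.Computability.AlgebraicComplexity
open Summit.MatrixMultiplication.MatrixMultiplication.Theses.FidelityWitnesses (SevenEighthsLaw)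

namespace SevenEighthsLawNeg

/-- Index type of one slot of `⟨2,2,2⟩`. [folklore] -/
abbrev P2 := Fin 2 × Fin 2

/-! ## Transfer: integer witnesses -/

/-- An integer tensor viewed over `ℂ`. [folklore] -/
def castT (Sz : P2 → P2 → P2 → ℤ) : P2 → P2 → P2 → ℂ := fun a b c => (Sz a b c : ℂ)

/-- The overlap `⟨Sz, ⟨2,2,2⟩⟩` over `ℤ`. [folklore] -/
def overlapZ (Sz : P2 → P2 → P2 → ℤ) : ℤ := ∑ a, ∑ b, ∑ c, Sz a b c * matMulTensor ℤ 2 2 2 a b c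

/-- The squared norm `Σ Sz²` over `ℤ`. [folklore] -/
def normSqZ (Sz : P2 → P2 → P2 → ℤ) : ℤ := ∑ a, ∑ b, ∑ c, Sz a b c ^ 2

/-- Base change of the overlap. [folklore] -/
theorem overlap_castT (Sz : P2 → P2 → P2 → ℤ) :
    (∑ a, ∑ b, ∑ c, castT Sz a b c * matMulTensor ℂ 2 2 2 a b c) = (overlapZ Sz : ℂ) := by
  unfold overlapZ castT
  push_cast
  refine Finset.sum_congr rfl fun a _ => Finset.sum_congr rfl fun b _ =>
    Finset.sum_congr rfl fun c _ => ?_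
  congr 1
  unfold matMulTensor
  split_ifs <;> simp

/-- Base change of the squared norm. [folklore] -/
theorem normSq_castT (Sz : P2 → P2 → P2 → ℤ) :
    (∑ a, ∑ b, ∑ c, ‖castT Sz a b c‖ ^ 2) = ((normSqZ Sz : ℤ) : ℝ) := by
  unfold normSqZ castT
  push_cast
  refine Finset.sum_congr rfl fun a _ => Finset.sum_congr rfl fun b _ =>
    Finset.sum_congr rfl fun c _ => ?_
  rw [Complex.norm_intCast, sq_abs]

/-- Base change does not raise the rank (`tensorRank_map_le` along `ℤ → ℂ`). [folklore] -/
theorem tensorRank_castT_le (Sz : P2 → P2 → P2 → ℤ) : tensorRank (castT Sz) ≤ tensorRank Sz :=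
  tensorRank_map_le (Int.castRingHom ℂ) Sz

/-- Squared overlap and squared norm of an integer tensor, read over `ℝ`. [folklore] -/
theorem ratio_castT (Sz : P2 → P2 → P2 → ℤ) :
    ‖∑ a, ∑ b, ∑ c, castT Sz a b c * matMulTensor ℂ 2 2 2 a b c‖ ^ 2 = ((overlapZ Sz ^ 2 : ℤ) : ℝ)
    ∧ (∑ a, ∑ b, ∑ c, ‖castT Sz a b c‖ ^ 2) = ((normSqZ Sz : ℤ) : ℝ) := by
  refine ⟨?_, normSq_castT Sz⟩
  rw [overlap_castT, Complex.norm_intCast, sq_abs]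
  push_cast
  rfl

/-- **Transfer.** An integer tensor of rank `≤ r` with `7·‖S‖² < ⟨S,T⟩²` is a complex tensor of rank
`≤ r` violating the `7/8` inequality. [folklore] -/
theorem violates_of_int (Sz : P2 → P2 → P2 → ℤ) (r : ℕ) (hr : tensorRank Sz ≤ r)
    (h : 7 * normSqZ Sz < overlapZ Sz ^ 2) :
    ∃ S : P2 → P2 → P2 → ℂ, tensorRank S ≤ r ∧
      7 * ∑ a, ∑ b, ∑ c, ‖S a b c‖ ^ 2 < ‖∑ a, ∑ b, ∑ c, S a b c * matMulTensor ℂ 2 2 2 a b c‖ ^ 2 := by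
  refine ⟨castT Sz, (tensorRank_castT_le Sz).trans hr, ?_⟩
  rw [(ratio_castT Sz).1, (ratio_castT Sz).2]
  exact_mod_cast h

end SevenEighthsLawNeg

open SevenEighthsLawNeg

/-- **Kill switch (integer form).** An integer tensor with an integer rank-`≤ 6` certificate and
`7·Σ Sz² < (Σ Sz·⟨2,2,2⟩)²` (both sides `decide`-able) refutes `SevenEighthsLaw`; by homogeneity of
the crux in `S` every counterexample with rational (or, via `ℤ[i]`, Gaussian) data reduces to this
shape. [folklore] -/
theorem sevenEighthsLaw_not_of_int (Sz : P2 → P2 → P2 → ℤ) (hr : tensorRank Sz ≤ 6)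
    (h : 7 * normSqZ Sz < overlapZ Sz ^ 2) : ¬ SevenEighthsLaw := by
  intro hlaw
  obtain ⟨S, hS, hlt⟩ := violates_of_int Sz 6 hr h
  exact absurd (hlaw S hS) (not_le.mpr hlt)

/-- **Kill switch (metric form).** A rank-`≤ 6` tensor at distance `< 1` from `⟨2,2,2⟩` refutes
`SevenEighthsLaw`: `‖T − S‖² = 8 − 2 Re ω + ‖S‖² ≥ (√7 − ‖S‖)² + (8 − 7) − (2|ω| − 2√7‖S‖) ≥ 1` when
`|ω|² ≤ 7‖S‖²` (`ω = Σ S·T`, `‖T‖² = 8`). [folklore] -/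
theorem sevenEighthsLaw_not_of_dist_lt_one
    (h : ∃ S : P2 → P2 → P2 → ℂ, tensorRank S ≤ 6 ∧
      (∑ a, ∑ b, ∑ c, ‖matMulTensor ℂ 2 2 2 a b c - S a b c‖ ^ 2) < 1) : ¬ SevenEighthsLaw := by
  rintro hlaw
  obtain ⟨S, hS, hd⟩ := h
  have key := hlaw S hS
  -- expand ‖T − S‖² = Σ ‖T‖² − 2 Re(S·T) + ‖S‖² entrywise (T real 0/1)
  set ω : ℂ := ∑ a, ∑ b, ∑ c, S a b c * matMulTensor ℂ 2 2 2 a b c with hω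
  set N : ℝ := ∑ a, ∑ b, ∑ c, ‖S a b c‖ ^ 2 with hN
  have hT8 : (∑ a : P2, ∑ b : P2, ∑ c : P2, ‖matMulTensor ℂ 2 2 2 a b c‖ ^ 2) = 8 := by
    simp [matMulTensor, Fintype.sum_prod_type, Fin.sum_univ_two]
    norm_num
  have hexp : (∑ a, ∑ b, ∑ c, ‖matMulTensor ℂ 2 2 2 a b c - S a b c‖ ^ 2)
      = 8 - 2 * ω.re + N := by
    have hentry : ∀ a b c : P2, ‖matMulTensor ℂ 2 2 2 a b c - S a b c‖ ^ 2 =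
        ‖matMulTensor ℂ 2 2 2 a b c‖ ^ 2 - 2 * (S a b c * matMulTensor ℂ 2 2 2 a b c).re
          + ‖S a b c‖ ^ 2 := by
      intro a b c
      rw [Complex.sq_norm, Complex.sq_norm, Complex.sq_norm, Complex.normSq_sub]
      simp only [matMulTensor]
      split_ifs <;> (simp [Complex.normSq_apply]; try ring)
    simp only [hentry, Finset.sum_add_distrib, Finset.sum_sub_distrib, ← Finset.mul_sum]
    rw [hT8, hω, hN]
    simp only [Complex.re_sum]
  rw [hexp] at hd
  -- |ω|² ≤ 7 N and Re ω ≤ |ω|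
  have hre : ω.re ≤ ‖ω‖ := Complex.re_le_norm ω
  have hN0 : 0 ≤ N := by
    rw [hN]; positivity
  have hωN : ‖ω‖ ^ 2 ≤ 7 * N := key
  have h7 : ‖ω‖ ≤ Real.sqrt 7 * Real.sqrt N := by
    rw [← Real.sqrt_mul (by norm_num : (0:ℝ) ≤ 7), ← Real.sqrt_sq (norm_nonneg ω)]
    exact Real.sqrt_le_sqrt hωN
  have hsN : Real.sqrt N ^ 2 = N := Real.sq_sqrt hN0
  have hs7 : Real.sqrt 7 ^ 2 = 7 := Real.sq_sqrt (by norm_num)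
  nlinarith [sq_nonneg (Real.sqrt 7 - Real.sqrt N), hre, h7, hsN, hs7,
    Real.sqrt_nonneg 7, Real.sqrt_nonneg N]

/-- **The crux is a unit-ball statement.** `SevenEighthsLaw` puts every rank-`≤ 6` tensor at distance
`≥ 1` from `⟨2,2,2⟩` (apply it to `c • S`, `c = conj ω / ‖S‖²`, a tensor of rank `≤ 6` by
`tensorRank_smul_le`, and expand). Together with `sevenEighthsLaw_not_of_dist_lt_one`:
the crux is exactly `dist(⟨2,2,2⟩, {R ≤ 6}) ≥ 1`. [folklore] -/
theorem sevenEighthsLaw_dist_ge_one (hlaw : SevenEighthsLaw) (S : P2 → P2 → P2 → ℂ)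
    (hS : tensorRank S ≤ 6) :
    1 ≤ ∑ a, ∑ b, ∑ c, ‖matMulTensor ℂ 2 2 2 a b c - S a b c‖ ^ 2 := by
  by_contra hlt
  rw [not_le] at hlt
  exact sevenEighthsLaw_not_of_dist_lt_one ⟨S, hS, hlt⟩ hlaw

/-! ## (a) Load-bearing: the rank bound is the whole content, and `6` is sharp -/

namespace SevenEighthsLawNeg

/-- `⟨2,2,2⟩` has overlap `8` with itself (its `8` ones). [folklore] -/
theorem overlapZ_matMul : overlapZ (matMulTensor ℤ 2 2 2) = 8 := by decide

/-- `‖⟨2,2,2⟩‖² = 8`. [folklore] -/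
theorem normSqZ_matMul : normSqZ (matMulTensor ℤ 2 2 2) = 8 := by decide

end SevenEighthsLawNeg

/-- Without the rank hypothesis the inequality fails at `S = ⟨2,2,2⟩` itself (`64 > 56`): any proof
must use `R(S) ≤ 6`. [folklore] -/
theorem sevenEighthsLaw_false_without_rank_bound : ¬ (∀ S : P2 → P2 → P2 → ℂ,
    ‖∑ a, ∑ b, ∑ c, S a b c * matMulTensor ℂ 2 2 2 a b c‖ ^ 2 ≤ 7 * ∑ a, ∑ b, ∑ c, ‖S a b c‖ ^ 2) := by
  intro h
  have key := h (castT (matMulTensor ℤ 2 2 2))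
  rw [(ratio_castT _).1, (ratio_castT _).2, overlapZ_matMul, normSqZ_matMul] at key
  norm_num at key

/-- With rank `≤ 7` in place of `≤ 6` the inequality fails (Strassen: `R(⟨2,2,2⟩) ≤ 7`, ratio `8`):
the threshold `6` is sharp on the rank side. [cite: Strassen1969] -/
theorem sevenEighthsLaw_false_with_rank_seven : ¬ (∀ S : P2 → P2 → P2 → ℂ, tensorRank S ≤ 7 →
    ‖∑ a, ∑ b, ∑ c, S a b c * matMulTensor ℂ 2 2 2 a b c‖ ^ 2 ≤ 7 * ∑ a, ∑ b, ∑ c, ‖S a b c‖ ^ 2) := by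
  intro h
  have hr : tensorRank (castT (matMulTensor ℤ 2 2 2)) ≤ 7 :=
    (tensorRank_castT_le _).trans (tensorRank_matMulTensor_two_le_seven ℤ)
  have key := h _ hr
  rw [(ratio_castT _).1, (ratio_castT _).2, overlapZ_matMul, normSqZ_matMul] at key
  norm_num at key

/-! ## (b) Tightness: the Bini-plus-one family, honest rank ≤ 6, ratio `7 − 28/(7m²+4)` -/

namespace SevenEighthsLawNeg

/-- Indicator of position `(i, j)` on `P2`, over `ℤ`. [folklore] -/
def e (i j : Fin 2) : P2 → ℤ := fun p => if p = (i, j) then 1 else 0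

/-- Z-slot factors (`γ`, output side; `c_{ki}` sits at position `(i,k)`) of the six triads.
[cite: BiniEtAl1979] -/
def biniW (m : ℤ) : Fin 6 → P2 → ℤ :=
  ![e 0 1, m • e 0 0 + e 1 0, m • e 0 0 + m • e 0 1 + e 1 1, e 0 0, m • e 0 0 + e 1 1, e 1 0]

/-- X-slot factors (`α`, the `a_{ij}`): `m a₁₂ + a₁₁, m a₂₁ + a₁₁, −m a₁₂, −m a₂₁, a₁₂ + a₂₁, m a₂₂`.
[cite: BiniEtAl1979] -/
def biniU (m : ℤ) : Fin 6 → P2 → ℤ :=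
  ![m • e 0 1 + e 0 0, m • e 1 0 + e 0 0, -(m • e 0 1), -(m • e 1 0), e 0 1 + e 1 0, m • e 1 1]

/-- Y-slot factors (`β`, the `b_{jk}`): `m b₁₂ + b₂₂, b₁₁, b₁₂, m b₁₁ + m b₁₂ + b₂₁, m b₁₂ + b₂₁, b₂₁`.
[cite: BiniEtAl1979] -/
def biniV (m : ℤ) : Fin 6 → P2 → ℤ :=
  ![m • e 0 1 + e 1 1, e 0 0, e 0 1, m • e 0 0 + m • e 0 1 + e 1 0, m • e 0 1 + e 1 0, e 1 0]

/-- `biniS m = Σ_{r<6} biniW m r ⊗ biniU m r ⊗ biniV m r = m·(⟨2,2,2⟩ − a₂₂⊗b₂₂⊗c₂₂) + C₂`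
(`C₂ = a₁₁b₂₂c₂₁ + a₁₁b₁₁c₁₂ + a₁₂b₂₁c₂₂ + a₂₁b₂₁c₂₂ ⊥ ⟨2,2,2⟩`): Bini's approximate algorithm
for `2×2` matrices with `a₂₂ = 0` plus one honest multiplication, at `ε = 1/m`, cleared of
denominators. [cite: BiniEtAl1979] -/
def biniS (m : ℤ) : P2 → P2 → P2 → ℤ := fun a b c => ∑ r, biniW m r a * biniU m r b * biniV m r c

/-- The integer rank certificate: `R(biniS m) ≤ 6` over `ℤ`. [cite: BiniEtAl1979] -/
theorem tensorRank_biniS_le (m : ℤ) : tensorRank (biniS m) ≤ 6 :=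
  tensorRank_le_of_eq_sum (biniW m) (biniU m) (biniV m)
    (by funext a b c; simp [biniS, Finset.sum_apply, triad_apply])

/-- Overlap of the Bini-plus-one tensor with `⟨2,2,2⟩`: `7m` (`C₂ ⊥ ⟨2,2,2⟩`). [cite: BiniEtAl1979] -/
theorem overlapZ_biniS (m : ℤ) : overlapZ (biniS m) = 7 * m := by
  simp [overlapZ, biniS, biniW, biniU, biniV, e, matMulTensor, Fintype.sum_prod_type,
    Fin.sum_univ_succ]
  ring

/-- Squared norm of the Bini-plus-one tensor: `7m² + 4` (`‖C₂‖² = 4`, `C₂ ⊥ ⟨2,2,2⟩ − E`).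
[cite: BiniEtAl1979] -/
theorem normSqZ_biniS (m : ℤ) : normSqZ (biniS m) = 7 * m ^ 2 + 4 := by
  simp [normSqZ, biniS, biniW, biniU, biniV, e, Fintype.sum_prod_type, Fin.sum_univ_succ]
  ring

end SevenEighthsLawNeg

/-- **The Bini-plus-one family** in the crux's own terms: for every integer `m` an honest rank-`≤ 6`
complex tensor with `|⟨S,T⟩|² = (7m)²` and `‖S‖² = 7m² + 4` (ratio `7 − 28/(7m² + 4)`).
[cite: BiniEtAl1979] -/
theorem sevenEighthsLaw_biniFamily (m : ℤ) : ∃ S : P2 → P2 → P2 → ℂ, tensorRank S ≤ 6 ∧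
    ‖∑ a, ∑ b, ∑ c, S a b c * matMulTensor ℂ 2 2 2 a b c‖ ^ 2 = (7 * m) ^ 2 ∧
    (∑ a, ∑ b, ∑ c, ‖S a b c‖ ^ 2) = 7 * m ^ 2 + 4 := by
  refine ⟨castT (biniS m), (tensorRank_castT_le _).trans (tensorRank_biniS_le m), ?_, ?_⟩
  · rw [(ratio_castT _).1, overlapZ_biniS]; push_cast; ring
  · rw [(ratio_castT _).2, normSqZ_biniS]; push_cast; ring

/-- **Tightness of `7`.** For every `η > 0` some honest rank-`≤ 6` tensor has
`(7 − η)·‖S‖² < |⟨S,⟨2,2,2⟩⟩|²`: the constant of `SevenEighthsLaw` cannot be lowered, the supremum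
`M(2,6) ≥ 7` is approached (from below) along the Bini-plus-one family. [cite: BiniEtAl1979] -/
theorem sevenEighthsLaw_tight (η : ℝ) (hη : 0 < η) : ∃ S : P2 → P2 → P2 → ℂ, tensorRank S ≤ 6 ∧
    (7 - η) * ∑ a, ∑ b, ∑ c, ‖S a b c‖ ^ 2 <
      ‖∑ a, ∑ b, ∑ c, S a b c * matMulTensor ℂ 2 2 2 a b c‖ ^ 2 := by
  obtain ⟨m, hm⟩ := exists_nat_gt (28 / η)
  obtain ⟨S, hS, h1, h2⟩ := sevenEighthsLaw_biniFamily (m : ℤ)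
  refine ⟨S, hS, ?_⟩
  rw [h1, h2]
  push_cast
  have hm0 : (0 : ℝ) ≤ m := Nat.cast_nonneg m
  have h28 : 28 < η * m := by rwa [div_lt_iff₀ hη, mul_comm] at hm
  nlinarith [mul_nonneg hm0 hm0, sq_nonneg ((m : ℝ)), h28, hη]

/-- The natural strengthening `7 ↦ 7 − 1/100` of `SevenEighthsLaw` is FALSE. [cite: BiniEtAl1979] -/
theorem sevenEighthsLaw_not_strengthened : ¬ (∀ S : P2 → P2 → P2 → ℂ, tensorRank S ≤ 6 →
    ‖∑ a, ∑ b, ∑ c, S a b c * matMulTensor ℂ 2 2 2 a b c‖ ^ 2 ≤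
      (7 - 1 / 100) * ∑ a, ∑ b, ∑ c, ‖S a b c‖ ^ 2) := by
  intro h
  obtain ⟨S, hS, hlt⟩ := sevenEighthsLaw_tight (1 / 100) (by norm_num)
  exact absurd (h S hS) (not_le.mpr hlt)

/-! ## (b') The supremum `7` is ATTAINED by an honest integer rank-6 tensor: `⟨2,2,2⟩ − a₂₂⊗b₂₂⊗c₂₂` -/

namespace SevenEighthsLawNeg

/-- A vector on `P2` from its four values at `(0,0), (0,1), (1,0), (1,1)`. [folklore] -/
def vec4 (v00 v01 v10 v11 : ℤ) : P2 → ℤ := fun p => ![![v00, v01], ![v10, v11]] p.1 p.2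

/-- Z-slot factors of Strassen's algorithm transported by the isotropy element
`(g,h,k) = ([[1,0],[1,1]], [[0,1],[1,0]], [[1,1],[0,1]])` that moves Strassen's product
`M₆ = (A₂₁ − A₁₁)(B₁₁ + B₁₂)` onto the standard term `a₂₂⊗b₂₂⊗c₂₂`; the six OTHER products.
[cite: Strassen1969] -/
def sixW : Fin 6 → P2 → ℤ :=
  ![vec4 1 1 (-1) 0, vec4 0 0 1 0, vec4 0 1 0 0, vec4 1 1 0 0, vec4 (-1) 0 1 0, vec4 1 1 (-1) (-1)]

/-- X-slot factors of the six transported Strassen products. [cite: Strassen1969] -/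
def sixU : Fin 6 → P2 → ℤ :=
  ![vec4 1 1 1 0, vec4 1 1 1 1, vec4 0 1 0 0, vec4 1 0 1 0, vec4 1 1 0 0, vec4 0 0 (-1) 0]

/-- Y-slot factors of the six transported Strassen products. [cite: Strassen1969] -/
def sixV : Fin 6 → P2 → ℤ :=
  ![vec4 (-1) 1 1 0, vec4 0 0 1 0, vec4 1 (-1) (-1) 1, vec4 1 0 (-1) 0, vec4 (-1) 1 0 0, vec4 0 1 0 0]

/-- `sixS = Σ_{r<6} sixW r ⊗ sixU r ⊗ sixV r`, an honest integer rank-`≤ 6` tensor. [cite: Strassen1969] -/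
def sixS : P2 → P2 → P2 → ℤ := fun a b c => ∑ r, sixW r a * sixU r b * sixV r c

/-- **`R(⟨2,2,2⟩ − a₂₂⊗b₂₂⊗c₂₂) ≤ 6`**: the six transported Strassen products sum to `⟨2,2,2⟩` minus
the standard term at `((1,1),(1,1),(1,1))` (all `64` entries, by `decide`). [cite: Strassen1969] -/
theorem sixS_eq : sixS = fun a b c =>
    matMulTensor ℤ 2 2 2 a b c - (if a = (1, 1) ∧ b = (1, 1) ∧ c = (1, 1) then 1 else 0) := by
  decide

/-- The integer rank certificate `R(sixS) ≤ 6`. [cite: Strassen1969] -/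
theorem tensorRank_sixS_le : tensorRank sixS ≤ 6 :=
  tensorRank_le_of_eq_sum sixW sixU sixV (by funext a b c; simp [sixS, Finset.sum_apply, triad_apply])

/-- Overlap `7` and squared norm `7`: ratio exactly `7`. [folklore] -/
theorem sixS_vals : overlapZ sixS = 7 ∧ normSqZ sixS = 7 := by decide

end SevenEighthsLawNeg

/-- **Equality in `SevenEighthsLaw` is attained by an honest rank-6 tensor**: for
`S = ⟨2,2,2⟩ − a₂₂⊗b₂₂⊗c₂₂` (rank `≤ 6`: Strassen's algorithm has, in adapted coordinates, a
standard term as one of its seven products), `‖S‖² = 7` and `|⟨S,⟨2,2,2⟩⟩|² = 49 = 7·‖S‖²`.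
So `M(2,6) ≥ 7` is a MAXIMUM over honest rank-6 tensors, not only a supremum, and any certificate of
the crux must be tight at `S` (and along its 6-real-dimensional orbit `⟨2,2,2⟩ − E_{xyz}` under the
compact stabiliser). [cite: Strassen1969] -/
theorem sevenEighthsLaw_attained : ∃ S : P2 → P2 → P2 → ℂ, tensorRank S ≤ 6 ∧
    (∑ a, ∑ b, ∑ c, ‖S a b c‖ ^ 2) = 7 ∧
    ‖∑ a, ∑ b, ∑ c, S a b c * matMulTensor ℂ 2 2 2 a b c‖ ^ 2 = 7 * ∑ a, ∑ b, ∑ c, ‖S a b c‖ ^ 2 := by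
  refine ⟨castT sixS, (tensorRank_castT_le _).trans tensorRank_sixS_le, ?_, ?_⟩
  · rw [(ratio_castT _).2, sixS_vals.2]; push_cast; ring
  · rw [(ratio_castT _).1, (ratio_castT _).2, sixS_vals.1, sixS_vals.2]; push_cast; norm_num

end Summit.MatrixMultiplication.MatrixMultiplication.Theorems
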